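/-
Copyright (c) 2026 the pub-hodgecm-mathlib formalisation cell (harness21).  Prover seat hodgecm-mathlib-K2E3-p23 (g7), HCML Track B «K2-LIT»,
h413 = `stmt-HodgeConjecture-24833`, line `K2_E3_EllipticInputs`, unit U12 «Characters», PART «SC» (ED. 2) leaf (SC-an)₂ ∕ socket (M5h)₂
`sig_K2E3SupercuspidalTruncatedCharAnalyticTwoOfEllWeight`, road «FC₂» (L4 EMIT #3 2026-09-04T15:02:09Z «TOP = THE (M5h)₂ PAYER»): the `Fin 2` twin of ★ (M5h‴) p857125
`K2E3SupercuspidalTruncatedCharAnalyticOfEllWeightPlace` (K2E5-p04 (g3)), FILE 1 of 2 (the engine along a field model), HYPOTHESIS-FIRST on the five N = 2 chain letters.  2026-09-04.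
-/
import Summits.HodgeConjecture.HodgeConjecture.Theorems.K2E3SupercuspidalTruncatedCharAnalyticOfEllWeightPlace   -- ★ (M5h‴) p857125: the `Fin 3` original; brings EVERY generic input used below (★ DominationOfBricks `sigSCan_datum_of_bricks` (any `N`), ★ HeightBallExhaustion, ★ TruncatedCharTransport, ★ WeightKit `exists_shellIndex`∕`locallyIntegrable_heightWeight`, ★ `localNonsplitEquiv`, frame)
import Summits.HodgeConjecture.HodgeConjecture.Theorems.K2E3HC14EllU11Haar                                  -- ★ (K2E5-p15 g3): `locallyCompactSpace_unitary` for `U(σ, J)(K)`, `J ∈ M₂(K)`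
import HarnessLib

/-!
# h413 ∕ Track B «K2-LIT», unit U12, PART «SC» leaf (SC-an)₂, road «FC₂» — THE (M5h)₂ ENGINE (FILE 1 of 2): THE (SC-an)₂ ∃-DATUM FOR A SUPERCUSPIDAL `SmoothIrrep` OF
# `U(Φ₂)(L⁺_v)` ALONG A FIELD MODEL `e : U(Φ₂)(L⁺_v) ≃ₜ* U(σ_w, Φ₂)(L_w)`, FROM «ELL-WEIGHT₂ AT THE PLACE» AND THE FIVE N = 2 CHAIN LETTERS (LIM₂, SHELL₂, TOK₂, TORΩ₂, DEPTH₂)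
# (Harish-Chandra 1970, Part VII §3 Theorem 16 and its proof pp. 70–73; Theorems 14, 15, 18–20 — for `U(1,1)`)

Cell `pub/hodgecm-mathlib`, crux H413 = `stmt-HodgeConjecture-24833`, route of record `HCCMUnconditional`; chair K2-lead (g2), L4 LINE-LEAD ∕ dealer K2E3-plan (g4),
architect K2E3-p25 (g3), (M5h)₂ chain desk K2E3-p27 (g0), map K2E3-p33 (g0).  THEOREMS ONLY (no `def`, no `instance`, no `notation`, no named-fact hypothesis, no `sorry`);
lane `--supports stmt-HodgeConjecture-24833 --as helper`, count-neutral.  FILE 2 = `Theorems/K2E3SupercuspidalTruncatedCharAnalyticTwoOfEllWeight.lean` (the (M5h)₂ socket shape).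

THE FILE = ★ (M5h‴) §1 TOKEN FOR TOKEN with `Fin 3 ↦ Fin 2`, `H ↦ Φ₂ = Matrix.of (i + j + 1 = 2)` (the (SC-an)₂ socket's form; ISOTROPIC at every place, so no (f2) dispatch and no
`…HC14Ell*` twin — K2E3-p33 (g0) map 2026-09-04T15:03:33Z), HYPOTHESIS-FIRST on the five N = 2 heads §1 calls (∀-closed; the `Fin 2` images of the ★ N = 3 heads, constants
FROZEN at their N = 3 values — each weaker than the 2 × 2 truth, so porters may prove sharper statements and weaken): **(LIM₂)** `hLIM` = ★ [M2c′]
`K2E3SupercuspidalTruncatedCharLimCancExplicit.explicit_limit_localisation_and_hball_reduction` (D144-2, K2E1-p10 (g3)); **(SHELL₂)** `hSHELL` = ★ (M5e-1‴) WeightKit §1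
`exists_const_integral_heightBall_norm_conj_le_shell_place`; **(TOK₂)** `hTOK` = ★ WeightKit §4 `locallyIntegrable_inv_token_mul_log_pow` at `k = 1` (payer ★ WeightKit₂ p861141
`…_place` ∘ its (ε6)₂ letter); **(TORΩ₂)** `hTORΩ` = ★ BallBoundSplitAssembly `v_pow_mul_torus_le_one_of_conj_mem`; **(DEPTH₂)** `hDEPTH` = ★ (M5e-2)
`K2E3SplitTorusDepthFromDiscriminant.v_pow_le_v_sub_of_pow_normAbs_le_token` (TORΩ₂, DEPTH₂ over the abstract model `U(σ, Φ₂)(K)`, `[CharZero K]` per the L4 ruling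
2026-09-04T14:55:23Z).  GENERIC ★ BY NAME (no twin): ★ `K2E3HeightBallExhaustion.exists_heightBall_compactExhaustion` (any `n`), ★ `sigSCan_datum_of_bricks L 2 Φ₂` (any `N`; `Φ₂` hermitian
with unit determinant ★ `antidiagOne_isHermitian` ∕ `isUnit_antidiagOne_det`), ★ `isCompact_centralizer_iff_of_continuousMulEquiv`, ★ WeightKit `exists_shellIndex` ∕
`locallyIntegrable_heightWeight`, ★ `discr_ne_zero_iff_separable`.  PROOF = ★ (M5h‴) §1 verbatim: `W := W_M ∘ e`, `W_M(m) = K₀·(h(m)+1)·q^{h(m)}·T(m)⁻¹(1+|log T(m)|) + Mb·W_E(m)`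
(`h = Ω_M.find`, `K₀ = C·Mb·A₀`, `A₀ = 24 m_θ + 579 + 160∕log q`, `W_E` from `hEW`), locally integrable by (TOK₂) + ★ `locallyIntegrable_heightWeight` + `hEW`; the first summand dominates
the split shell bound ((SHELL₂), ★ `exists_shellIndex`, `λ_min ≤ 4τ + 10h` by (TORΩ₂)+(DEPTH₂), radius clause of (LIM₂)), the second the elliptic full-orbital bound; ★
`sigSCan_datum_of_bricks` concludes.  HEAD **`sigSCan_datum_of_ellWeightPlace_of_fieldModel_two (hLIM hSHELL hTOK hTORΩ hDEPTH hEW) (L) (v) (hns) (w) (hw) [..] (μ) [..] (e) (r) (hsc) (B) (hBinv) (v₁)`**.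

HONEST LABEL.  HC_CM is proved only modulo the 7 printed citations (2 remaining named inputs: hLiu418 = `stmt-HodgeConjecture-24832`, h413 = `stmt-HodgeConjecture-24833`)
until rung 0 closes; count-neutral; (M5h)₂ becomes REL over EXACTLY {LIM₂, SHELL₂, TOK₂, TORΩ₂, DEPTH₂} when FILE 2 is tied — NOT ★.

## References
* [HarishChandra1970] Harish-Chandra (notes by G. van Dijk), *Harmonic Analysis on Reductive p-adic Groups*, LNM 162 (1970), Part VI §8 Theorem 14 p. 60; Part VII §1 Thm. 15
  p. 63, §2 Theorems 18–20 pp. 69–70, §3 Theorem 16 p. 67 and pp. 70–73.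
* [Rogawski1990] J. D. Rogawski, *Automorphic Representations of Unitary Groups in Three Variables*, Ann. of Math. Stud. 123 (1990), §4.9 p. 54, §7.3 p. 97, §12.2 p. 173, §12.5 p. 182.
* [Folland1995] G. B. Folland, *A Course in Abstract Harmonic Analysis* (1995), §2.4.
-/

set_option autoImplicit false
-- the mandated namespace repeats the single-problem summit's segment (`HodgeConjecture.HodgeConjecture`)
set_option linter.dupNamespace false

noncomputable section

open MeasureTheory Measure Set Filter Topology NumberField IsDedekindDomain
open scoped NNReal ENNReal Pointwise Matrix MatrixGroups WithZero
open ValuativeRel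
open Literature.NumberTheory.Automorphic Literature.NumberTheory.Automorphic.UnitaryGroup Literature.NumberTheory.Automorphic.HermitianLattice Literature.NumberTheory.Rogawski1990
open Literature.NumberTheory.GaloisRepresentations Literature.NumberTheory.GaloisRepresentations.IsNonarchimedeanLocalField

namespace Summit.HodgeConjecture.HodgeConjecture.Cruxes.H413.K2E3SupercuspidalTruncatedCharAnalyticOfEllWeightPlaceTwo

/-! ## §1 The engine along a field model `e`, modulo «ELL-WEIGHT₂» AT THE PLACE and the five N = 2 letters -/
set_option maxHeartbeats 3200000 in -- long statement (six ∀-closed letters as binders) and the long (M5h‴) assembly on the CM ∕ one-place carriers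
/-- **(SC-an)₂ DATUM ALONG A FIELD MODEL `e : U(Φ₂)(L⁺_v) ≃ₜ* U(σ_w, Φ₂)(L_w)`, MODULO «ELL-WEIGHT₂» AT THE PLACE AND THE LETTERS (LIM₂) (SHELL₂) (TOK₂) (TORΩ₂) (DEPTH₂)** —
★ (M5h‴) `sigSCan_datum_of_ellWeightPlace_of_fieldModel` at `Fin 2`, `H = Φ₂`: the weight `W := W_M ∘ e`, `W_M(m) = K₀·(h(m)+1)·q^{h(m)}·T(m)⁻¹(1+|log T(m)|) + Mb·W_E(m)`,
locally integrable ((TOK₂) + `hEW`), the first summand dominating the split shell bound ((SHELL₂), `τ = ⌈log_q T⁻¹⌉₊` ★ `exists_shellIndex`, `λ_min ≤ 4τ + 10h` by (TORΩ₂)+(DEPTH₂),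
radius of (LIM₂)), the second the elliptic full-orbital bound (`hEW` at `S := Ω_M m_θ`, `Θ := ‖θ_M‖ₑ`, `Mb := ‖θ‖_∞`); ★ `sigSCan_datum_of_bricks` (any `N`) concludes.
[cite: HarishChandra1970, Part VII §3 Theorem 16 p. 67, pp. 70–73; Part VI §8 Theorem 14 p. 60; Part VII §1 Thm. 15 p. 63] [cite: Rogawski1990, §4.9 p. 54, §7.3 p. 97, §12.5 p. 182] -/
theorem sigSCan_datum_of_ellWeightPlace_of_fieldModel_two
    (hLIM : ∀ (L : Type) [Field L] [NumberField L] [IsCMField L] {v : HeightOneSpectrum (𝓞 ↥(maximalRealSubfield L))} (w : PlacesOver L v) (hw : IsCMField.complexConj L • w.1 = w.1)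
          [MeasurableSpace ((UnitaryGroup.cmDatum L 2 (Matrix.of fun i j : Fin 2 => if i.val + j.val + 1 = 2 then (1 : L) else 0)).Local v)] [BorelSpace ((UnitaryGroup.cmDatum L 2 (Matrix.of fun i j : Fin 2 => if i.val + j.val + 1 = 2 then (1 : L) else 0)).Local v)]
          (μ : Measure ((UnitaryGroup.cmDatum L 2 (Matrix.of fun i j : Fin 2 => if i.val + j.val + 1 = 2 then (1 : L) else 0)).Local v)) [μ.IsHaarMeasure]
          [MeasurableSpace ↥(unitaryGroupOfForm (galAdicCompletionMap (L := L) (IsCMField.complexConj L) hw) ((StdForm.antidiagonal 2).over (w.1.adicCompletion L)))]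
          [BorelSpace ↥(unitaryGroupOfForm (galAdicCompletionMap (L := L) (IsCMField.complexConj L) hw) ((StdForm.antidiagonal 2).over (w.1.adicCompletion L)))]
          (e : (UnitaryGroup.cmDatum L 2 (Matrix.of fun i j : Fin 2 => if i.val + j.val + 1 = 2 then (1 : L) else 0)).Local v ≃ₜ*
            ↥(unitaryGroupOfForm (galAdicCompletionMap (L := L) (IsCMField.complexConj L) hw) ((StdForm.antidiagonal 2).over (w.1.adicCompletion L))))
          (ΩM : CompactExhaustion ↥(unitaryGroupOfForm (galAdicCompletionMap (L := L) (IsCMField.complexConj L) hw) ((StdForm.antidiagonal 2).over (w.1.adicCompletion L))))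
          {ϖ : w.1.adicCompletion L} (hϖ : Valued.v ϖ = WithZero.exp (-1 : ℤ))
          (hmem : ∀ (m : ℕ) (g : ↥(unitaryGroupOfForm (galAdicCompletionMap (L := L) (IsCMField.complexConj L) hw) ((StdForm.antidiagonal 2).over (w.1.adicCompletion L)))), g ∈ ΩM m ↔
            (∀ i j, Valued.v (ϖ ^ m * ((g : GL (Fin 2) (w.1.adicCompletion L)) : Matrix (Fin 2) (Fin 2) (w.1.adicCompletion L)) i j) ≤ 1) ∧
              ∀ i j, Valued.v (ϖ ^ m * (((g : GL (Fin 2) (w.1.adicCompletion L))⁻¹ : GL (Fin 2) (w.1.adicCompletion L)) : Matrix (Fin 2) (Fin 2) (w.1.adicCompletion L)) i j) ≤ 1)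
          (hinv : ∀ (m : ℕ) (g : ↥(unitaryGroupOfForm (galAdicCompletionMap (L := L) (IsCMField.complexConj L) hw) ((StdForm.antidiagonal 2).over (w.1.adicCompletion L)))), g ∈ ΩM m → g⁻¹ ∈ ΩM m)
          (hmul : ∀ (a b : ℕ) (g h : ↥(unitaryGroupOfForm (galAdicCompletionMap (L := L) (IsCMField.complexConj L) hw) ((StdForm.antidiagonal 2).over (w.1.adicCompletion L)))),
            g ∈ ΩM a → h ∈ ΩM b → g * h ∈ ΩM (a + b))
          {V : Type} [AddCommGroup V] [Module ℂ V] (ρ : Representation ℂ ((UnitaryGroup.cmDatum L 2 (Matrix.of fun i j : Fin 2 => if i.val + j.val + 1 = 2 then (1 : L) else 0)).Local v) V) (hsm : ρ.IsSmooth) (hsc : ρ.IsSupercuspidal)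
          (B : V →ₗ⋆[ℂ] V →ₗ[ℂ] ℂ) (hBinv : ∀ (g : (UnitaryGroup.cmDatum L 2 (Matrix.of fun i j : Fin 2 => if i.val + j.val + 1 = 2 then (1 : L) else 0)).Local v) (x y : V), B (ρ g x) (ρ g y) = B x y) (u u' : V),
          ∃ (Ω : CompactExhaustion ((UnitaryGroup.cmDatum L 2 (Matrix.of fun i j : Fin 2 => if i.val + j.val + 1 = 2 then (1 : L) else 0)).Local v)) (R : (UnitaryGroup.cmDatum L 2 (Matrix.of fun i j : Fin 2 => if i.val + j.val + 1 = 2 then (1 : L) else 0)).Local v → ℕ) (mθ : ℕ)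
            (F : (UnitaryGroup.cmDatum L 2 (Matrix.of fun i j : Fin 2 => if i.val + j.val + 1 = 2 then (1 : L) else 0)).Local v → ℂ) (Bset : (UnitaryGroup.cmDatum L 2 (Matrix.of fun i j : Fin 2 => if i.val + j.val + 1 = 2 then (1 : L) else 0)).Local v → Set ((UnitaryGroup.cmDatum L 2 (Matrix.of fun i j : Fin 2 => if i.val + j.val + 1 = 2 then (1 : L) else 0)).Local v)),
            (∀ n : ℕ, (Ω n : Set ((UnitaryGroup.cmDatum L 2 (Matrix.of fun i j : Fin 2 => if i.val + j.val + 1 = 2 then (1 : L) else 0)).Local v)) = e ⁻¹' (ΩM n)) ∧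
            (∀ g, Bset g = e ⁻¹' (ΩM (R g))) ∧ (∀ g, IsCompact (Bset g)) ∧ (∀ᵐ g ∂μ, ¬ (IsRegularElt (g.val : GL (Fin 2) (UnitaryGroup.LocalRing L v)) ∧
                IsCompact ((Subgroup.centralizer ({g} : Set ((UnitaryGroup.cmDatum L 2 (Matrix.of fun i j : Fin 2 => if i.val + j.val + 1 = 2 then (1 : L) else 0)).Local v))) : Set ((UnitaryGroup.cmDatum L 2 (Matrix.of fun i j : Fin 2 => if i.val + j.val + 1 = 2 then (1 : L) else 0)).Local v))) →
              Tendsto (fun n => ∫ x in Ω n, B u' (ρ (x * g * x⁻¹) u) ∂μ) atTop (𝓝 (F g))) ∧ (∀ n : ℕ, ∀ᵐ g ∂μ, ¬ (IsRegularElt (g.val : GL (Fin 2) (UnitaryGroup.LocalRing L v)) ∧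
                IsCompact ((Subgroup.centralizer ({g} : Set ((UnitaryGroup.cmDatum L 2 (Matrix.of fun i j : Fin 2 => if i.val + j.val + 1 = 2 then (1 : L) else 0)).Local v))) : Set ((UnitaryGroup.cmDatum L 2 (Matrix.of fun i j : Fin 2 => if i.val + j.val + 1 = 2 then (1 : L) else 0)).Local v))) →
              ∫ x in Ω n, B u' (ρ (x * g * x⁻¹) u) ∂μ = ∫ x in Ω n ∩ Bset g, B u' (ρ (x * g * x⁻¹) u) ∂μ) ∧
            (∀ m' : ↥(unitaryGroupOfForm (galAdicCompletionMap (L := L) (IsCMField.complexConj L) hw) ((StdForm.antidiagonal 2).over (w.1.adicCompletion L))),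
              B u' (ρ (e.symm m') u) ≠ 0 → m' ∈ ΩM mθ) ∧
            (∀ g : (UnitaryGroup.cmDatum L 2 (Matrix.of fun i j : Fin 2 => if i.val + j.val + 1 = 2 then (1 : L) else 0)).Local v, IsRegularElt ((e g : ↥(unitaryGroupOfForm (galAdicCompletionMap (L := L) (IsCMField.complexConj L) hw)
                ((StdForm.antidiagonal 2).over (w.1.adicCompletion L)))) : GL (Fin 2) (w.1.adicCompletion L)) →
              ¬ IsCompact ((Subgroup.centralizer ({g} : Set ((UnitaryGroup.cmDatum L 2 (Matrix.of fun i j : Fin 2 => if i.val + j.val + 1 = 2 then (1 : L) else 0)).Local v))) : Set ((UnitaryGroup.cmDatum L 2 (Matrix.of fun i j : Fin 2 => if i.val + j.val + 1 = 2 then (1 : L) else 0)).Local v)) →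
              ∃ (t y₀ : ↥(unitaryGroupOfForm (galAdicCompletionMap (L := L) (IsCMField.complexConj L) hw) ((StdForm.antidiagonal 2).over (w.1.adicCompletion L))))
                (d : Fin 2 → (w.1.adicCompletion L)ˣ) (lam mg : ℕ),
                glDiagonal 2 (w.1.adicCompletion L) d = (t : GL (Fin 2) (w.1.adicCompletion L)) ∧ IsRegularElt (t : GL (Fin 2) (w.1.adicCompletion L)) ∧
                (∀ i k : Fin 2, i ≠ k → Valued.v (ϖ ^ lam) ≤ Valued.v ((d i : w.1.adicCompletion L) - d k)) ∧
                (∀ lam' : ℕ, (∀ i k : Fin 2, i ≠ k → Valued.v (ϖ ^ lam') ≤ Valued.v ((d i : w.1.adicCompletion L) - d k)) → lam ≤ lam') ∧ e g ∈ ΩM mg ∧ (∀ m' : ℕ, e g ∈ ΩM m' → mg ≤ m') ∧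
                y₀ ∈ ΩM (2 * mg + 2 * lam) ∧ e g = y₀ * t * y₀⁻¹ ∧ R g = 5 * (2 * mθ + 2 * lam) + 3 * (2 * mg + 2 * lam) + 1) ∧
            (∀ᵐ g ∂μ, IsRegularElt ((e g : ↥(unitaryGroupOfForm (galAdicCompletionMap (L := L) (IsCMField.complexConj L) hw)
                ((StdForm.antidiagonal 2).over (w.1.adicCompletion L)))) : GL (Fin 2) (w.1.adicCompletion L))) ∧
            (∀ W_M : ↥(unitaryGroupOfForm (galAdicCompletionMap (L := L) (IsCMField.complexConj L) hw) ((StdForm.antidiagonal 2).over (w.1.adicCompletion L))) → ℝ,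
              (∀ᵐ g ∂μ, ¬ (IsRegularElt (g.val : GL (Fin 2) (UnitaryGroup.LocalRing L v)) ∧
                  IsCompact ((Subgroup.centralizer ({g} : Set ((UnitaryGroup.cmDatum L 2 (Matrix.of fun i j : Fin 2 => if i.val + j.val + 1 = 2 then (1 : L) else 0)).Local v))) : Set ((UnitaryGroup.cmDatum L 2 (Matrix.of fun i j : Fin 2 => if i.val + j.val + 1 = 2 then (1 : L) else 0)).Local v))) →
                ∫ x' in ΩM (R g), ‖B u' (ρ (e.symm (x' * e g * x'⁻¹)) u)‖ ∂(μ.map e) ≤ W_M (e g)) → ∀ᵐ g ∂μ, ¬ (IsRegularElt (g.val : GL (Fin 2) (UnitaryGroup.LocalRing L v)) ∧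
                  IsCompact ((Subgroup.centralizer ({g} : Set ((UnitaryGroup.cmDatum L 2 (Matrix.of fun i j : Fin 2 => if i.val + j.val + 1 = 2 then (1 : L) else 0)).Local v))) : Set ((UnitaryGroup.cmDatum L 2 (Matrix.of fun i j : Fin 2 => if i.val + j.val + 1 = 2 then (1 : L) else 0)).Local v))) →
                ∫ x in Bset g, ‖B u' (ρ (x * g * x⁻¹) u)‖ ∂μ ≤ W_M (e g)) ∧
            (∀ W_M : ↥(unitaryGroupOfForm (galAdicCompletionMap (L := L) (IsCMField.complexConj L) hw) ((StdForm.antidiagonal 2).over (w.1.adicCompletion L))) → ℝ,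
              (∀ᵐ g ∂μ, (IsRegularElt (g.val : GL (Fin 2) (UnitaryGroup.LocalRing L v)) ∧
                  IsCompact ((Subgroup.centralizer ({g} : Set ((UnitaryGroup.cmDatum L 2 (Matrix.of fun i j : Fin 2 => if i.val + j.val + 1 = 2 then (1 : L) else 0)).Local v))) : Set ((UnitaryGroup.cmDatum L 2 (Matrix.of fun i j : Fin 2 => if i.val + j.val + 1 = 2 then (1 : L) else 0)).Local v))) →
                ∫ x', ‖B u' (ρ (e.symm (x' * e g * x'⁻¹)) u)‖ ∂(μ.map e) ≤ W_M (e g)) → ∀ᵐ g ∂μ, (IsRegularElt (g.val : GL (Fin 2) (UnitaryGroup.LocalRing L v)) ∧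
                  IsCompact ((Subgroup.centralizer ({g} : Set ((UnitaryGroup.cmDatum L 2 (Matrix.of fun i j : Fin 2 => if i.val + j.val + 1 = 2 then (1 : L) else 0)).Local v))) : Set ((UnitaryGroup.cmDatum L 2 (Matrix.of fun i j : Fin 2 => if i.val + j.val + 1 = 2 then (1 : L) else 0)).Local v))) →
                ∫ x, ‖B u' (ρ (x * g * x⁻¹) u)‖ ∂μ ≤ W_M (e g)))
    (hSHELL : ∀ (L : Type) [Field L] [NumberField L] [IsCMField L] {v : HeightOneSpectrum (𝓞 ↥(maximalRealSubfield L))} (w : PlacesOver L v) (hw : IsCMField.complexConj L • w.1 = w.1)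
          [MeasurableSpace ↥(unitaryGroupOfForm (galAdicCompletionMap (L := L) (IsCMField.complexConj L) hw) ((StdForm.antidiagonal 2).over (w.1.adicCompletion L)))]
          [BorelSpace ↥(unitaryGroupOfForm (galAdicCompletionMap (L := L) (IsCMField.complexConj L) hw) ((StdForm.antidiagonal 2).over (w.1.adicCompletion L)))]
          (ν : Measure ↥(unitaryGroupOfForm (galAdicCompletionMap (L := L) (IsCMField.complexConj L) hw) ((StdForm.antidiagonal 2).over (w.1.adicCompletion L)))) [ν.IsHaarMeasure]
          (Ω : CompactExhaustion ↥(unitaryGroupOfForm (galAdicCompletionMap (L := L) (IsCMField.complexConj L) hw) ((StdForm.antidiagonal 2).over (w.1.adicCompletion L)))) {ϖ : w.1.adicCompletion L}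
          (hϖ : Valued.v ϖ = WithZero.exp (-1 : ℤ))
          (hmem : ∀ (m : ℕ) (g : ↥(unitaryGroupOfForm (galAdicCompletionMap (L := L) (IsCMField.complexConj L) hw) ((StdForm.antidiagonal 2).over (w.1.adicCompletion L)))), g ∈ Ω m ↔
            (∀ i j, Valued.v (ϖ ^ m * ((g : GL (Fin 2) (w.1.adicCompletion L)) : Matrix (Fin 2) (Fin 2) (w.1.adicCompletion L)) i j) ≤ 1) ∧
              ∀ i j, Valued.v (ϖ ^ m * (((g : GL (Fin 2) (w.1.adicCompletion L))⁻¹ : GL (Fin 2) (w.1.adicCompletion L)) : Matrix (Fin 2) (Fin 2) (w.1.adicCompletion L)) i j) ≤ 1)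
          (hinv : ∀ (m : ℕ) (g : ↥(unitaryGroupOfForm (galAdicCompletionMap (L := L) (IsCMField.complexConj L) hw) ((StdForm.antidiagonal 2).over (w.1.adicCompletion L)))), g ∈ Ω m → g⁻¹ ∈ Ω m)
          (hmul : ∀ (a b : ℕ) (g h : ↥(unitaryGroupOfForm (galAdicCompletionMap (L := L) (IsCMField.complexConj L) hw) ((StdForm.antidiagonal 2).over (w.1.adicCompletion L)))), g ∈ Ω a → h ∈ Ω b → g * h ∈ Ω (a + b))
          (mθ : ℕ),
          ∃ C : ℝ≥0, ∀ (θ : ↥(unitaryGroupOfForm (galAdicCompletionMap (L := L) (IsCMField.complexConj L) hw) ((StdForm.antidiagonal 2).over (w.1.adicCompletion L))) → ℂ), Continuous θ → (∀ g, θ g ≠ 0 → g ∈ Ω mθ) →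
            ∀ (M : ℝ≥0), (∀ g, ‖θ g‖₊ ≤ M) →
            ∀ (t : ↥(torusU (galAdicCompletionMap (L := L) (IsCMField.complexConj L) hw) ((StdForm.antidiagonal 2).over (w.1.adicCompletion L)))) (d : Fin 2 → (w.1.adicCompletion L)ˣ),
              glDiagonal 2 (w.1.adicCompletion L) d = ((t : ↥(unitaryGroupOfForm (galAdicCompletionMap (L := L) (IsCMField.complexConj L) hw) ((StdForm.antidiagonal 2).over (w.1.adicCompletion L)))) : GL (Fin 2) (w.1.adicCompletion L)) →
              ∀ (g y : ↥(unitaryGroupOfForm (galAdicCompletionMap (L := L) (IsCMField.complexConj L) hw) ((StdForm.antidiagonal 2).over (w.1.adicCompletion L)))) (m : ℕ), g ∈ Ω m →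
                g = y * (t : ↥(unitaryGroupOfForm (galAdicCompletionMap (L := L) (IsCMField.complexConj L) hw) ((StdForm.antidiagonal 2).over (w.1.adicCompletion L)))) * y⁻¹ →
              ∀ (τ : ℕ), normAbs (w.1.adicCompletion L) ϖ ^ τ ≤ NNReal.sqrt (NNReal.sqrt
                  (normAbs (w.1.adicCompletion L) (((g : GL (Fin 2) (w.1.adicCompletion L)) : Matrix (Fin 2) (Fin 2) (w.1.adicCompletion L))).charpoly.discr *
                    (normAbs (w.1.adicCompletion L) (((g : GL (Fin 2) (w.1.adicCompletion L)) : Matrix (Fin 2) (Fin 2) (w.1.adicCompletion L))).det ^ 2)⁻¹)) → ∀ (R : ℕ),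
                ∫ x in Ω R, ‖θ (x * g * x⁻¹)‖ ∂ν ≤ C * M * ((2 * (R + 42 * m + 2 * mθ + 16 * τ) + 1 : ℕ) : ℝ) * ((residueFieldCard (w.1.adicCompletion L) : ℝ≥0) : ℝ) ^ m * ((NNReal.sqrt (NNReal.sqrt
                      (normAbs (w.1.adicCompletion L) (((g : GL (Fin 2) (w.1.adicCompletion L)) : Matrix (Fin 2) (Fin 2) (w.1.adicCompletion L))).charpoly.discr *
                        (normAbs (w.1.adicCompletion L) (((g : GL (Fin 2) (w.1.adicCompletion L)) : Matrix (Fin 2) (Fin 2) (w.1.adicCompletion L))).det ^ 2)⁻¹)))⁻¹ : ℝ))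
    (hTOK : ∀ (L : Type) [Field L] [NumberField L] [IsCMField L] {v : HeightOneSpectrum (𝓞 ↥(maximalRealSubfield L))} (w : PlacesOver L v) (hw : IsCMField.complexConj L • w.1 = w.1)
          [MeasurableSpace ↥(unitaryGroupOfForm (galAdicCompletionMap (L := L) (IsCMField.complexConj L) hw) ((StdForm.antidiagonal 2).over (w.1.adicCompletion L)))]
          [BorelSpace ↥(unitaryGroupOfForm (galAdicCompletionMap (L := L) (IsCMField.complexConj L) hw) ((StdForm.antidiagonal 2).over (w.1.adicCompletion L)))]
          (ν : Measure ↥(unitaryGroupOfForm (galAdicCompletionMap (L := L) (IsCMField.complexConj L) hw) ((StdForm.antidiagonal 2).over (w.1.adicCompletion L)))) [ν.IsHaarMeasure],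
          LocallyIntegrable (fun m : ↥(unitaryGroupOfForm (galAdicCompletionMap (L := L) (IsCMField.complexConj L) hw) ((StdForm.antidiagonal 2).over (w.1.adicCompletion L))) =>
            (((NNReal.sqrt (NNReal.sqrt (normAbs (w.1.adicCompletion L) (((m : GL (Fin 2) (w.1.adicCompletion L)) : Matrix (Fin 2) (Fin 2) (w.1.adicCompletion L))).charpoly.discr *
                (normAbs (w.1.adicCompletion L) (((m : GL (Fin 2) (w.1.adicCompletion L)) : Matrix (Fin 2) (Fin 2) (w.1.adicCompletion L))).det ^ 2)⁻¹)) : ℝ≥0) : ℝ))⁻¹ *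
              (1 + |Real.log (((NNReal.sqrt (NNReal.sqrt (normAbs (w.1.adicCompletion L) (((m : GL (Fin 2) (w.1.adicCompletion L)) : Matrix (Fin 2) (Fin 2) (w.1.adicCompletion L))).charpoly.discr *
                  (normAbs (w.1.adicCompletion L) (((m : GL (Fin 2) (w.1.adicCompletion L)) : Matrix (Fin 2) (Fin 2) (w.1.adicCompletion L))).det ^ 2)⁻¹)) : ℝ≥0) : ℝ))|) ^ 1) ν)
    (hTORΩ : ∀ (K : Type) [Field K] [Valued K ℤᵐ⁰] [ValuativeRel K] [(Valued.v : Valuation K ℤᵐ⁰).Compatible] [IsNonarchimedeanLocalField K] [CharZero K]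
      (σ : K →+* K), (∀ x, σ (σ x) = x) → (∀ x, Valued.v (σ x) = Valued.v x) → ∀ {ϖ : K}, Valued.v ϖ = WithZero.exp (-1 : ℤ) → ∀ {J : Matrix (Fin 2) (Fin 2) K}, J = (StdForm.antidiagonal 2).over K →
      ∀ (Ω : CompactExhaustion ↥(unitaryGroupOfForm σ J)), (∀ (m : ℕ) (g : ↥(unitaryGroupOfForm σ J)), g ∈ Ω m ↔ (∀ i j, Valued.v (ϖ ^ m * ((g : GL (Fin 2) K) : Matrix (Fin 2) (Fin 2) K) i j) ≤ 1) ∧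
          ∀ i j, Valued.v (ϖ ^ m * (((g : GL (Fin 2) K)⁻¹ : GL (Fin 2) K) : Matrix (Fin 2) (Fin 2) K) i j) ≤ 1) →
      ∀ {t y : ↥(unitaryGroupOfForm σ J)} {d : Fin 2 → Kˣ}, glDiagonal 2 K d = (t : GL (Fin 2) K) →
        ∀ {m : ℕ}, y * t * y⁻¹ ∈ Ω m → ∀ i : Fin 2, Valued.v (ϖ ^ m * (d i : K)) ≤ 1 ∧ Valued.v (ϖ ^ m * ((d i : K))⁻¹) ≤ 1)
    (hDEPTH : ∀ (K : Type) [Field K] [Valued K ℤᵐ⁰] [ValuativeRel K] [(Valued.v : Valuation K ℤᵐ⁰).Compatible] [IsNonarchimedeanLocalField K] [CharZero K]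
      {ϖ : K}, Valued.v ϖ = WithZero.exp (-1 : ℤ) → ∀ {d : Fin 2 → Kˣ} {m : ℕ}, (∀ i, Valued.v (ϖ ^ m * (d i : K)) ≤ 1) → (∀ i, Valued.v (ϖ ^ m * ((d i : K))⁻¹) ≤ 1) → ∀ {τ : ℕ},
      normAbs K ϖ ^ τ ≤ NNReal.sqrt (NNReal.sqrt (normAbs K ((((glDiagonal 2 K d : GL (Fin 2) K) : Matrix (Fin 2) (Fin 2) K)).charpoly.discr) *
          (normAbs K ((((glDiagonal 2 K d : GL (Fin 2) K) : Matrix (Fin 2) (Fin 2) K)).det) ^ 2)⁻¹)) → ∀ {i k : Fin 2}, i ≠ k → Valued.v (ϖ ^ (4 * τ + 10 * m)) ≤ Valued.v ((d i : K) - d k))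
    (hEW : ∀ (L' : Type) [Field L'] [NumberField L'] [IsCMField L'] {v' : HeightOneSpectrum (𝓞 ↥(maximalRealSubfield L'))}
      (w' : UnitaryGroup.PlacesOver L' v') (hw' : IsCMField.complexConj L' • w'.1 = w'.1)
      [MeasurableSpace ↥(unitaryGroupOfForm (galAdicCompletionMap (L := L') (IsCMField.complexConj L') hw') ((StdForm.antidiagonal 2).over (w'.1.adicCompletion L')))]
      [BorelSpace ↥(unitaryGroupOfForm (galAdicCompletionMap (L := L') (IsCMField.complexConj L') hw') ((StdForm.antidiagonal 2).over (w'.1.adicCompletion L')))]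
      (μ' : Measure ↥(unitaryGroupOfForm (galAdicCompletionMap (L := L') (IsCMField.complexConj L') hw') ((StdForm.antidiagonal 2).over (w'.1.adicCompletion L')))) [μ'.IsHaarMeasure]
      {S : Set ↥(unitaryGroupOfForm (galAdicCompletionMap (L := L') (IsCMField.complexConj L') hw') ((StdForm.antidiagonal 2).over (w'.1.adicCompletion L')))} (_ : IsCompact S),
      ∃ W_E : ↥(unitaryGroupOfForm (galAdicCompletionMap (L := L') (IsCMField.complexConj L') hw') ((StdForm.antidiagonal 2).over (w'.1.adicCompletion L'))) → ℝ,
        LocallyIntegrable W_E μ' ∧ (∀ g, 0 ≤ W_E g) ∧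
        ∀ γ : ↥(unitaryGroupOfForm (galAdicCompletionMap (L := L') (IsCMField.complexConj L') hw') ((StdForm.antidiagonal 2).over (w'.1.adicCompletion L'))),
          IsRegularElt (γ : GL (Fin 2) (w'.1.adicCompletion L')) →
          IsCompact ((Subgroup.centralizer ({γ} : Set ↥(unitaryGroupOfForm (galAdicCompletionMap (L := L') (IsCMField.complexConj L') hw') ((StdForm.antidiagonal 2).over (w'.1.adicCompletion L'))))) :
              Set ↥(unitaryGroupOfForm (galAdicCompletionMap (L := L') (IsCMField.complexConj L') hw') ((StdForm.antidiagonal 2).over (w'.1.adicCompletion L')))) →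
            ∀ Θ : ↥(unitaryGroupOfForm (galAdicCompletionMap (L := L') (IsCMField.complexConj L') hw') ((StdForm.antidiagonal 2).over (w'.1.adicCompletion L'))) → ℝ≥0∞,
              Measurable Θ → (∀ g, Θ g ≠ 0 → g ∈ S) → ∀ Mb : ℝ≥0∞, (∀ g, Θ g ≤ Mb) → ∫⁻ x, Θ (x * γ * x⁻¹) ∂μ' ≤ ENNReal.ofReal (W_E γ) * Mb)
    (L : Type) [Field L] [NumberField L] [IsCMField L]
    (v : HeightOneSpectrum (𝓞 ↥(maximalRealSubfield L))) (hns : ∀ w : PlacesOver L v, IsCMField.complexConj L • w.1 = w.1) (w : PlacesOver L v) (hw : IsCMField.complexConj L • w.1 = w.1)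
    [MeasurableSpace ((UnitaryGroup.cmDatum L 2 (Matrix.of fun i j : Fin 2 => if i.val + j.val + 1 = 2 then (1 : L) else 0)).Local v)] [BorelSpace ((UnitaryGroup.cmDatum L 2 (Matrix.of fun i j : Fin 2 => if i.val + j.val + 1 = 2 then (1 : L) else 0)).Local v)]
    (μ : Measure ((UnitaryGroup.cmDatum L 2 (Matrix.of fun i j : Fin 2 => if i.val + j.val + 1 = 2 then (1 : L) else 0)).Local v)) [μ.IsHaarMeasure]
    (e : (UnitaryGroup.cmDatum L 2 (Matrix.of fun i j : Fin 2 => if i.val + j.val + 1 = 2 then (1 : L) else 0)).Local v ≃ₜ*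
      ↥(unitaryGroupOfForm (galAdicCompletionMap (L := L) (IsCMField.complexConj L) hw) ((StdForm.antidiagonal 2).over (w.1.adicCompletion L))))
    (r : SmoothIrrep ((UnitaryGroup.cmDatum L 2 (Matrix.of fun i j : Fin 2 => if i.val + j.val + 1 = 2 then (1 : L) else 0)).Local v)) (hsc : r.ρ.IsSupercuspidal)
    (B : r.V →ₗ⋆[ℂ] r.V →ₗ[ℂ] ℂ) (hBinv : ∀ (g : (UnitaryGroup.cmDatum L 2 (Matrix.of fun i j : Fin 2 => if i.val + j.val + 1 = 2 then (1 : L) else 0)).Local v) (x y : r.V), B (r.ρ g x) (r.ρ g y) = B x y) (v₁ : r.V) :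
    ∃ (Ω' : CompactExhaustion ((UnitaryGroup.cmDatum L 2 (Matrix.of fun i j : Fin 2 => if i.val + j.val + 1 = 2 then (1 : L) else 0)).Local v))
      (F' : (UnitaryGroup.cmDatum L 2 (Matrix.of fun i j : Fin 2 => if i.val + j.val + 1 = 2 then (1 : L) else 0)).Local v → ℂ) (M : (UnitaryGroup.cmDatum L 2 (Matrix.of fun i j : Fin 2 => if i.val + j.val + 1 = 2 then (1 : L) else 0)).Local v → ℝ),
      (∀ᵐ g ∂μ, ¬ (IsRegularElt (g.val : GL (Fin 2) (UnitaryGroup.LocalRing L v)) ∧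
          IsCompact ((Subgroup.centralizer ({g} : Set ((UnitaryGroup.cmDatum L 2 (Matrix.of fun i j : Fin 2 => if i.val + j.val + 1 = 2 then (1 : L) else 0)).Local v))) : Set ((UnitaryGroup.cmDatum L 2 (Matrix.of fun i j : Fin 2 => if i.val + j.val + 1 = 2 then (1 : L) else 0)).Local v))) →
        Tendsto (fun n => ∫ x in Ω' n, B v₁ (r.ρ (x * g * x⁻¹) v₁) ∂μ) atTop (𝓝 (F' g))) ∧ (∀ n : ℕ, ∀ᵐ g ∂μ, ‖∫ x in Ω' n, B v₁ (r.ρ (x * g * x⁻¹) v₁) ∂μ‖ ≤ M g) ∧ LocallyIntegrable M μ := by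
  letI iM : MeasurableSpace ↥(unitaryGroupOfForm (galAdicCompletionMap (L := L) (IsCMField.complexConj L) hw) ((StdForm.antidiagonal 2).over (w.1.adicCompletion L))) :=
    borel _
  haveI : BorelSpace ↥(unitaryGroupOfForm (galAdicCompletionMap (L := L) (IsCMField.complexConj L) hw) ((StdForm.antidiagonal 2).over (w.1.adicCompletion L))) := ⟨rfl⟩
  haveI : (μ.map e).IsHaarMeasure := ContinuousMulEquiv.isHaarMeasure_map μ e
  haveI : CharZero (w.1.adicCompletion L) := charZero_of_injective_algebraMap (algebraMap L (w.1.adicCompletion L)).injective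
  have hσc : Continuous (galAdicCompletionMap (L := L) (IsCMField.complexConj L) hw) := continuous_galAdicCompletionMap L (IsCMField.complexConj L) hw
  haveI : SecondCountableTopology ↥(unitaryGroupOfForm (galAdicCompletionMap (L := L) (IsCMField.complexConj L) hw) ((StdForm.antidiagonal 2).over (w.1.adicCompletion L))) :=
    K2E3SupercuspModelFrameAtPlace.secondCountableTopology_unitaryGroupOfForm_adicCompletion L w _ _
  haveI : LocallyCompactSpace ↥(unitaryGroupOfForm (galAdicCompletionMap (L := L) (IsCMField.complexConj L) hw) ((StdForm.antidiagonal 2).over (w.1.adicCompletion L))) :=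
    K2E3HC14EllU11Haar.locallyCompactSpace_unitary hσc _
  have hσσ : ∀ x, galAdicCompletionMap (L := L) (IsCMField.complexConj L) hw (galAdicCompletionMap (L := L) (IsCMField.complexConj L) hw x) = x :=
    galAdicCompletionMap_galAdicCompletionMap_of_smul_eq (IsCMField.complexConj L) w (IsCMField.complexConj_ne_one L) hw
  have hσv : ∀ x, Valued.v (galAdicCompletionMap (L := L) (IsCMField.complexConj L) hw x) = Valued.v x :=
    fun x => valued_galAdicCompletionMap (L := L) (IsCMField.complexConj L) hw x
  haveI := compactSpace_integer_adicCompletion L w.1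
  obtain ⟨ϖ, hϖ⟩ := exists_v_eq_exp_neg_one_adicCompletion (E := L) w.1
  obtain ⟨ΩM, hmem, -, hinv, hmul, -⟩ := K2E3HeightBallExhaustion.exists_heightBall_compactExhaustion
    (galAdicCompletionMap (L := L) (IsCMField.complexConj L) hw) ((StdForm.antidiagonal 2).over (w.1.adicCompletion L)) hσc hϖ
  obtain ⟨Ω, R, mθ, F, Bset, -, -, hBsetc, hlim, hcanc, hθ, hdat, hregae, hballR, hballER⟩ :=
    hLIM L w hw μ e ΩM hϖ hmem hinv hmul r.ρ r.isSmooth hsc B hBinv v₁ v₁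
  -- the model coefficient `θ_M`: continuous, supported in `Ω_M m_θ`, bounded by `Mb`
  have hθMc : Continuous fun m' : ↥(unitaryGroupOfForm (galAdicCompletionMap (L := L) (IsCMField.complexConj L) hw) ((StdForm.antidiagonal 2).over (w.1.adicCompletion L))) =>
      B v₁ (r.ρ (e.symm m') v₁) := (Representation.continuous_sesqForm_apply_apply (r.isSmooth v₁) v₁).comp e.symm.continuous
  have hθMcs : HasCompactSupport fun m' : ↥(unitaryGroupOfForm (galAdicCompletionMap (L := L) (IsCMField.complexConj L) hw)
      ((StdForm.antidiagonal 2).over (w.1.adicCompletion L))) => B v₁ (r.ρ (e.symm m') v₁) :=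
    HasCompactSupport.intro (ΩM.isCompact mθ) fun m' hm' => not_not.1 fun h => hm' (hθ m' h)
  obtain ⟨M₀, hM₀⟩ := hθMcs.exists_bound_of_continuous hθMc
  have hMb : ∀ m' : ↥(unitaryGroupOfForm (galAdicCompletionMap (L := L) (IsCMField.complexConj L) hw) ((StdForm.antidiagonal 2).over (w.1.adicCompletion L))),
      ‖B v₁ (r.ρ (e.symm m') v₁)‖₊ ≤ Real.toNNReal M₀ := fun m' => by
    rw [← NNReal.coe_le_coe, coe_nnnorm]
    exact (hM₀ m').trans (Real.le_coe_toNNReal M₀)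
  -- the token as an opaque function, its positivity at regular elements
  obtain ⟨T, hT⟩ : ∃ T : ↥(unitaryGroupOfForm (galAdicCompletionMap (L := L) (IsCMField.complexConj L) hw) ((StdForm.antidiagonal 2).over (w.1.adicCompletion L))) → ℝ≥0,
      ∀ m', T m' = NNReal.sqrt (NNReal.sqrt
        (normAbs (w.1.adicCompletion L) (((m' : GL (Fin 2) (w.1.adicCompletion L)) : Matrix (Fin 2) (Fin 2) (w.1.adicCompletion L))).charpoly.discr *
          (normAbs (w.1.adicCompletion L) (((m' : GL (Fin 2) (w.1.adicCompletion L)) : Matrix (Fin 2) (Fin 2) (w.1.adicCompletion L))).det ^ 2)⁻¹)) := ⟨_, fun _ => rfl⟩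
  have hT0 : ∀ m' : ↥(unitaryGroupOfForm (galAdicCompletionMap (L := L) (IsCMField.complexConj L) hw) ((StdForm.antidiagonal 2).over (w.1.adicCompletion L))),
      IsRegularElt (m' : GL (Fin 2) (w.1.adicCompletion L)) → T m' ≠ 0 := fun m' hreg => by
    have hdisc : (((m' : GL (Fin 2) (w.1.adicCompletion L)) : Matrix (Fin 2) (Fin 2) (w.1.adicCompletion L))).charpoly.discr ≠ 0 :=
      (Literature.Algebra.Polynomial.DiscriminantSignRealRoots.discr_ne_zero_iff_separable
        (by rw [Matrix.charpoly_degree_eq_dim, Fintype.card_fin]; exact_mod_cast (by norm_num : (0 : ℕ) < 2))).2 hreg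
    have hdet' : (((m' : GL (Fin 2) (w.1.adicCompletion L)) : Matrix (Fin 2) (Fin 2) (w.1.adicCompletion L))).det ≠ 0 := by
      have h := (Matrix.GeneralLinearGroup.det (m' : GL (Fin 2) (w.1.adicCompletion L))).ne_zero
      rwa [Matrix.GeneralLinearGroup.val_det_apply] at h
    rw [hT]
    intro h
    have h' := NNReal.sqrt_eq_zero.1 (NNReal.sqrt_eq_zero.1 h)
    exact mul_ne_zero ((map_ne_zero _).2 hdisc) (inv_ne_zero (pow_ne_zero 2 ((map_ne_zero _).2 hdet'))) h'
  -- the split constant (★ FILE A §1) and the elliptic weight `W_E` (the HYPOTHESIS at `S := Ω_M m_θ`)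
  obtain ⟨C, hC⟩ := hSHELL L w hw (μ.map e) ΩM hϖ hmem hinv hmul mθ
  obtain ⟨WE, hWEli, hWE0, hWE⟩ := hEW L w hw (μ.map e) (ΩM.isCompact mθ)
  -- `q`, `log q`, the constants `A₀`, `K₀` and the weight `W_M`
  have hq1 : (1 : ℝ) < ((residueFieldCard (w.1.adicCompletion L) : ℝ≥0) : ℝ) := by exact_mod_cast one_lt_residueFieldCard_nnreal (F := w.1.adicCompletion L)
  have hlogq : 0 < Real.log ((residueFieldCard (w.1.adicCompletion L) : ℝ≥0) : ℝ) := Real.log_pos hq1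
  set A₀ : ℝ := 24 * (mθ : ℝ) + 579 + 160 / Real.log ((residueFieldCard (w.1.adicCompletion L) : ℝ≥0) : ℝ) with hA₀
  have hA₀0 : 0 ≤ A₀ := by positivity
  set K₀ : ℝ := (C : ℝ) * (Real.toNNReal M₀ : ℝ) * A₀ with hK₀
  have hCM0 : 0 ≤ (C : ℝ) * (Real.toNNReal M₀ : ℝ) := mul_nonneg C.2 (Real.toNNReal M₀).2
  have hK₀0 : 0 ≤ K₀ := mul_nonneg hCM0 hA₀0
  have hK₀ge' : (C : ℝ) * (Real.toNNReal M₀ : ℝ) * A₀ ≤ K₀ := hK₀.symm.le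
  set W_M : ↥(unitaryGroupOfForm (galAdicCompletionMap (L := L) (IsCMField.complexConj L) hw) ((StdForm.antidiagonal 2).over (w.1.adicCompletion L))) → ℝ :=
    fun m' => K₀ * ((ΩM.find m' : ℝ) + 1) * ((residueFieldCard (w.1.adicCompletion L) : ℝ≥0) : ℝ) ^ (ΩM.find m') *
      (((T m' : ℝ))⁻¹ * (1 + |Real.log (T m' : ℝ)|) ^ 1) + (Real.toNNReal M₀ : ℝ) * WE m' with hW_M
  -- `W_M ∈ L¹_loc(M, e_* μ)` (★ FILE A §4–§5 for the split summand, `hEW` for the elliptic one), transported to `G`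
  have hf := hTOK L w hw (μ.map e)
  simp only [← hT] at hf
  have hWM : LocallyIntegrable W_M (μ.map e) := by
    have h := (K2E3SupercuspidalTruncatedCharWeightKit.locallyIntegrable_heightWeight (μ.map e) ΩM hf hK₀0 hq1.le).add (hWEli.smul (Real.toNNReal M₀ : ℝ))
    rw [Pi.add_def, Pi.smul_def] at h
    simpa only [hW_M, smul_eq_mul] using h
  have hcoe : (⇑e.toHomeomorph : (UnitaryGroup.cmDatum L 2 (Matrix.of fun i j : Fin 2 => if i.val + j.val + 1 = 2 then (1 : L) else 0)).Local v → _) = ⇑e := rfl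
  have hW : LocallyIntegrable (fun g : (UnitaryGroup.cmDatum L 2 (Matrix.of fun i j : Fin 2 => if i.val + j.val + 1 = 2 then (1 : L) else 0)).Local v => W_M (e g)) μ := by
    have h := (locallyIntegrable_map_homeomorph (μ := μ) e.toHomeomorph (f := W_M)).1 (by rw [hcoe]; exact hWM)
    rw [hcoe] at h
    exact h
  -- the split summand of `W_M` is nonnegative
  have hWMpos : ∀ m', (0 : ℝ) ≤ K₀ * ((ΩM.find m' : ℝ) + 1) * ((residueFieldCard (w.1.adicCompletion L) : ℝ≥0) : ℝ) ^ (ΩM.find m') *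
      (((T m' : ℝ))⁻¹ * (1 + |Real.log (T m' : ℝ)|) ^ 1) := fun m' =>
    mul_nonneg (mul_nonneg (mul_nonneg hK₀0 (by positivity)) (pow_nonneg (zero_le_one.trans hq1.le) _))
      (mul_nonneg (inv_nonneg.2 (T m').2) (pow_nonneg (by positivity) _))
  -- THE ELLIPTIC BOUND from «ELL-WEIGHT»: for `e g` regular with compact `Z_M(e g)`, the full orbital integral of `‖θ_M‖` is finite and `≤ Mb·W_E(e g) ≤ W_M (e g)`
  have hell : ∀ g : (UnitaryGroup.cmDatum L 2 (Matrix.of fun i j : Fin 2 => if i.val + j.val + 1 = 2 then (1 : L) else 0)).Local v,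
      IsRegularElt ((e g : ↥(unitaryGroupOfForm (galAdicCompletionMap (L := L) (IsCMField.complexConj L) hw) ((StdForm.antidiagonal 2).over (w.1.adicCompletion L)))) :
        GL (Fin 2) (w.1.adicCompletion L)) →
      IsCompact ((Subgroup.centralizer ({e g} : Set ↥(unitaryGroupOfForm (galAdicCompletionMap (L := L) (IsCMField.complexConj L) hw) ((StdForm.antidiagonal 2).over (w.1.adicCompletion L))))) :
        Set ↥(unitaryGroupOfForm (galAdicCompletionMap (L := L) (IsCMField.complexConj L) hw) ((StdForm.antidiagonal 2).over (w.1.adicCompletion L)))) →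
      Integrable (fun x' : ↥(unitaryGroupOfForm (galAdicCompletionMap (L := L) (IsCMField.complexConj L) hw) ((StdForm.antidiagonal 2).over (w.1.adicCompletion L))) =>
        B v₁ (r.ρ (e.symm (x' * e g * x'⁻¹)) v₁)) (μ.map e) ∧
      ∫ x', ‖B v₁ (r.ρ (e.symm (x' * e g * x'⁻¹)) v₁)‖ ∂(μ.map e) ≤ W_M (e g) := by
    intro g hreg hZM
    -- the hypothesis at `Θ := ‖θ_M‖ₑ`, `γ := e g`, `Mb := ‖θ‖_∞`
    have hL := hWE (e g) hreg hZM (fun m' => (‖B v₁ (r.ρ (e.symm m') v₁)‖₊ : ℝ≥0∞)) (measurable_coe_nnreal_ennreal.comp hθMc.nnnorm.measurable)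
      (fun m' hm' => hθ m' fun h0 => hm' (by rw [h0, nnnorm_zero, ENNReal.coe_zero])) (Real.toNNReal M₀ : ℝ≥0∞) (fun m' => ENNReal.coe_le_coe.2 (hMb m'))
    have htop : ENNReal.ofReal (WE (e g)) * ((Real.toNNReal M₀ : ℝ≥0) : ℝ≥0∞) ≠ ⊤ := ENNReal.mul_ne_top ENNReal.ofReal_ne_top ENNReal.coe_ne_top
    have hItop : ∫⁻ x', (‖B v₁ (r.ρ (e.symm (x' * e g * x'⁻¹)) v₁)‖₊ : ℝ≥0∞) ∂(μ.map e) < ∞ := lt_of_le_of_lt hL htop.lt_top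
    have hcont : Continuous fun x' : ↥(unitaryGroupOfForm (galAdicCompletionMap (L := L) (IsCMField.complexConj L) hw) ((StdForm.antidiagonal 2).over (w.1.adicCompletion L))) =>
        B v₁ (r.ρ (e.symm (x' * e g * x'⁻¹)) v₁) := hθMc.comp ((continuous_id.mul continuous_const).mul continuous_inv)
    have hint : Integrable (fun x' : ↥(unitaryGroupOfForm (galAdicCompletionMap (L := L) (IsCMField.complexConj L) hw) ((StdForm.antidiagonal 2).over (w.1.adicCompletion L))) =>
        B v₁ (r.ρ (e.symm (x' * e g * x'⁻¹)) v₁)) (μ.map e) := ⟨hcont.aestronglyMeasurable, hItop⟩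
    refine ⟨hint, ?_⟩
    rw [integral_norm_eq_lintegral_enorm hcont.aestronglyMeasurable]
    have hle : (∫⁻ x', ‖B v₁ (r.ρ (e.symm (x' * e g * x'⁻¹)) v₁)‖ₑ ∂(μ.map e)).toReal ≤
        (ENNReal.ofReal (WE (e g)) * ((Real.toNNReal M₀ : ℝ≥0) : ℝ≥0∞)).toReal := ENNReal.toReal_mono htop hL
    refine hle.trans ?_
    rw [ENNReal.toReal_mul, ENNReal.toReal_ofReal (hWE0 _), ENNReal.coe_toReal, mul_comm]
    calc (Real.toNNReal M₀ : ℝ) * WE (e g)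
        ≤ K₀ * ((ΩM.find (e g) : ℝ) + 1) * ((residueFieldCard (w.1.adicCompletion L) : ℝ≥0) : ℝ) ^ (ΩM.find (e g)) *
            (((T (e g) : ℝ))⁻¹ * (1 + |Real.log (T (e g) : ℝ)|) ^ 1) + (Real.toNNReal M₀ : ℝ) * WE (e g) := le_add_of_nonneg_left (hWMpos (e g))
      _ = W_M (e g) := by rw [hW_M]
  -- THE SPLIT BOUND at the exported datum (★ FILE A §1, shell index ★ FILE A §2, depth ★ (M5e-2))
  have hsplit : ∀ g : (UnitaryGroup.cmDatum L 2 (Matrix.of fun i j : Fin 2 => if i.val + j.val + 1 = 2 then (1 : L) else 0)).Local v,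
      IsRegularElt ((e g : ↥(unitaryGroupOfForm (galAdicCompletionMap (L := L) (IsCMField.complexConj L) hw) ((StdForm.antidiagonal 2).over (w.1.adicCompletion L)))) :
        GL (Fin 2) (w.1.adicCompletion L)) →
      ¬ IsCompact ((Subgroup.centralizer ({g} : Set ((UnitaryGroup.cmDatum L 2 (Matrix.of fun i j : Fin 2 => if i.val + j.val + 1 = 2 then (1 : L) else 0)).Local v))) : Set ((UnitaryGroup.cmDatum L 2 (Matrix.of fun i j : Fin 2 => if i.val + j.val + 1 = 2 then (1 : L) else 0)).Local v)) →
      ∫ x' in ΩM (R g), ‖B v₁ (r.ρ (e.symm (x' * e g * x'⁻¹)) v₁)‖ ∂(μ.map e) ≤ W_M (e g) := by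
    intro g hreg hZ
    obtain ⟨t, y₀, d, lam, mg, hd, -, -, hlam_min, hgm, hmg_min, -, hgy, hR⟩ := hdat g hreg hZ
    have hmg : mg = ΩM.find (e g) := le_antisymm (hmg_min _ (ΩM.mem_find _)) (ΩM.mem_iff_find_le.1 hgm)
    subst hmg
    have hTg := hT0 (e g) hreg
    obtain ⟨τ, hτ, hτle⟩ := K2E3SupercuspidalTruncatedCharWeightKit.exists_shellIndex hϖ (pos_iff_ne_zero.2 hTg)
    rw [hT] at hτ
    have htT : t ∈ torusU (galAdicCompletionMap (L := L) (IsCMField.complexConj L) hw) ((StdForm.antidiagonal 2).over (w.1.adicCompletion L)) :=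
      (mem_torusU_iff t).2 ⟨d, hd⟩
    -- depth on the shell: `λ_min ≤ 4τ + 10 h`
    have hgt : y₀ * t * y₀⁻¹ ∈ ΩM (ΩM.find (e g)) := by rw [← hgy]; exact hgm
    have hdm := fun i => (hTORΩ _ _ hσσ hσv hϖ rfl ΩM hmem hd hgt i).1
    have hdm' := fun i => (hTORΩ _ _ hσσ hσv hϖ rfl ΩM hmem hd hgt i).2
    have hcoe' : ((e g : ↥(unitaryGroupOfForm (galAdicCompletionMap (L := L) (IsCMField.complexConj L) hw) ((StdForm.antidiagonal 2).over (w.1.adicCompletion L)))) :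
        GL (Fin 2) (w.1.adicCompletion L)) =
        (y₀ : GL (Fin 2) (w.1.adicCompletion L)) * (glDiagonal 2 (w.1.adicCompletion L) d : GL (Fin 2) (w.1.adicCompletion L)) * (y₀ : GL (Fin 2) (w.1.adicCompletion L))⁻¹ := by
      rw [hgy, hd]; rfl
    have hchar : ((((e g : ↥(unitaryGroupOfForm (galAdicCompletionMap (L := L) (IsCMField.complexConj L) hw) ((StdForm.antidiagonal 2).over (w.1.adicCompletion L)))) :
        GL (Fin 2) (w.1.adicCompletion L)) : Matrix (Fin 2) (Fin 2) (w.1.adicCompletion L))).charpoly =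
        (((glDiagonal 2 (w.1.adicCompletion L) d : GL (Fin 2) (w.1.adicCompletion L)) : Matrix (Fin 2) (Fin 2) (w.1.adicCompletion L))).charpoly := by
      rw [hcoe', Units.val_mul, Units.val_mul, Matrix.coe_units_inv]
      exact Matrix.charpoly_units_conj (y₀ : GL (Fin 2) (w.1.adicCompletion L)) _
    have hdet' : ((((e g : ↥(unitaryGroupOfForm (galAdicCompletionMap (L := L) (IsCMField.complexConj L) hw) ((StdForm.antidiagonal 2).over (w.1.adicCompletion L)))) :
        GL (Fin 2) (w.1.adicCompletion L)) : Matrix (Fin 2) (Fin 2) (w.1.adicCompletion L))).det =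
        (((glDiagonal 2 (w.1.adicCompletion L) d : GL (Fin 2) (w.1.adicCompletion L)) : Matrix (Fin 2) (Fin 2) (w.1.adicCompletion L))).det := by
      rw [hcoe', Units.val_mul, Units.val_mul]
      exact Matrix.det_units_conj (y₀ : GL (Fin 2) (w.1.adicCompletion L)) _
    have hτ' := hτ
    rw [hchar, hdet'] at hτ'
    have hdepth : ∀ i k : Fin 2, i ≠ k → Valued.v (ϖ ^ (4 * τ + 10 * ΩM.find (e g))) ≤ Valued.v ((d i : w.1.adicCompletion L) - d k) := fun i k hik =>
      hDEPTH _ hϖ hdm hdm' hτ' hik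
    have hlam : lam ≤ 4 * τ + 10 * ΩM.find (e g) := hlam_min _ hdepth
    have hN : (2 * (R g + 42 * ΩM.find (e g) + 2 * mθ + 16 * τ) + 1 : ℕ) ≤ 24 * mθ + 416 * ΩM.find (e g) + 160 * τ + 3 := by rw [hR]; omega
    have hN' : ((2 * (R g + 42 * ΩM.find (e g) + 2 * mθ + 16 * τ) + 1 : ℕ) : ℝ) ≤ 24 * (mθ : ℝ) + 416 * (ΩM.find (e g) : ℝ) + 160 * (τ : ℝ) + 3 := by
      exact_mod_cast hN
    -- the shell bound (★ FILE A §1)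
    have hshell := hC (fun m' => B v₁ (r.ρ (e.symm m') v₁)) hθMc hθ (Real.toNNReal M₀) hMb ⟨t, htT⟩ d hd (e g) y₀ (ΩM.find (e g)) hgm hgy τ hτ (R g)
    rw [← hT] at hshell
    refine hshell.trans ?_
    -- `(N : ℝ) ≤ A₀ · (h + 1) · (1 + |log T|)`
    set X : ℝ := |Real.log (T (e g) : ℝ)| with hX
    have hX0 : 0 ≤ X := abs_nonneg _
    have hm0 : (0 : ℝ) ≤ (ΩM.find (e g) : ℝ) := Nat.cast_nonneg _
    have hP1 : (1 : ℝ) ≤ ((ΩM.find (e g) : ℝ) + 1) * (1 + X) := one_le_mul_of_one_le_of_one_le (by linarith) (by linarith)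
    have hP0 : (0 : ℝ) ≤ ((ΩM.find (e g) : ℝ) + 1) * (1 + X) := zero_le_one.trans hP1
    have hτX : (τ : ℝ) ≤ 1 + X / Real.log ((residueFieldCard (w.1.adicCompletion L) : ℝ≥0) : ℝ) := hτle
    have hc0 : (0 : ℝ) ≤ 160 / Real.log ((residueFieldCard (w.1.adicCompletion L) : ℝ≥0) : ℝ) := by positivity
    have hNA : ((2 * (R g + 42 * ΩM.find (e g) + 2 * mθ + 16 * τ) + 1 : ℕ) : ℝ) ≤ A₀ * (((ΩM.find (e g) : ℝ) + 1) * (1 + X)) := by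
      have h1 : (24 * (mθ : ℝ) + 163) ≤ (24 * (mθ : ℝ) + 163) * (((ΩM.find (e g) : ℝ) + 1) * (1 + X)) := le_mul_of_one_le_right (by positivity) hP1
      have h2 : 416 * (ΩM.find (e g) : ℝ) ≤ 416 * (((ΩM.find (e g) : ℝ) + 1) * (1 + X)) := by nlinarith
      have h3 : 160 * (τ : ℝ) ≤ 160 + 160 / Real.log ((residueFieldCard (w.1.adicCompletion L) : ℝ≥0) : ℝ) * X := by
        have := mul_le_mul_of_nonneg_left hτX (by norm_num : (0 : ℝ) ≤ 160)
        rw [mul_add, mul_one, mul_div_assoc'] at this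
        linarith [this, show 160 * X / Real.log ((residueFieldCard (w.1.adicCompletion L) : ℝ≥0) : ℝ) =
          160 / Real.log ((residueFieldCard (w.1.adicCompletion L) : ℝ≥0) : ℝ) * X by ring]
      have h4 : 160 / Real.log ((residueFieldCard (w.1.adicCompletion L) : ℝ≥0) : ℝ) * X ≤
          160 / Real.log ((residueFieldCard (w.1.adicCompletion L) : ℝ≥0) : ℝ) * (((ΩM.find (e g) : ℝ) + 1) * (1 + X)) :=
        mul_le_mul_of_nonneg_left (by nlinarith) hc0
      rw [hA₀]
      nlinarith
    -- assemble: `C·Mb·N·q^h·T⁻¹ ≤ K₀·(h+1)·q^h·(T⁻¹(1+|log T|))`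
    have hqh : (0 : ℝ) ≤ ((residueFieldCard (w.1.adicCompletion L) : ℝ≥0) : ℝ) ^ (ΩM.find (e g)) := pow_nonneg (zero_le_one.trans hq1.le) _
    have hTinv : (0 : ℝ) ≤ ((T (e g) : ℝ))⁻¹ := inv_nonneg.2 (T (e g)).2
    calc (C : ℝ) * (Real.toNNReal M₀ : ℝ) * ((2 * (R g + 42 * ΩM.find (e g) + 2 * mθ + 16 * τ) + 1 : ℕ) : ℝ) *
          ((residueFieldCard (w.1.adicCompletion L) : ℝ≥0) : ℝ) ^ (ΩM.find (e g)) * ((T (e g) : ℝ))⁻¹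
        ≤ (C : ℝ) * (Real.toNNReal M₀ : ℝ) * (A₀ * (((ΩM.find (e g) : ℝ) + 1) * (1 + X))) *
          ((residueFieldCard (w.1.adicCompletion L) : ℝ≥0) : ℝ) ^ (ΩM.find (e g)) * ((T (e g) : ℝ))⁻¹ :=
          mul_le_mul_of_nonneg_right (mul_le_mul_of_nonneg_right (mul_le_mul_of_nonneg_left hNA hCM0) hqh) hTinv
      _ = ((C : ℝ) * (Real.toNNReal M₀ : ℝ) * A₀) * (((ΩM.find (e g) : ℝ) + 1) * ((residueFieldCard (w.1.adicCompletion L) : ℝ≥0) : ℝ) ^ (ΩM.find (e g)) *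
          (((T (e g) : ℝ))⁻¹ * (1 + X) ^ 1)) := by ring
      _ ≤ K₀ * (((ΩM.find (e g) : ℝ) + 1) * ((residueFieldCard (w.1.adicCompletion L) : ℝ≥0) : ℝ) ^ (ΩM.find (e g)) *
          (((T (e g) : ℝ))⁻¹ * (1 + X) ^ 1)) :=
          mul_le_mul_of_nonneg_right hK₀ge' (mul_nonneg (mul_nonneg (by linarith) hqh) (mul_nonneg hTinv (by rw [pow_one]; linarith)))
      _ ≤ K₀ * (((ΩM.find (e g) : ℝ) + 1) * ((residueFieldCard (w.1.adicCompletion L) : ℝ≥0) : ℝ) ^ (ΩM.find (e g)) *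
          (((T (e g) : ℝ))⁻¹ * (1 + X) ^ 1)) + (Real.toNNReal M₀ : ℝ) * WE (e g) := le_add_of_nonneg_right (mul_nonneg (Real.toNNReal M₀).2 (hWE0 _))
      _ = W_M (e g) := by rw [hW_M, hX]; ring
  -- `hball`, `hballE` through the two reductions of ★ FILE B, then ★ p856355
  have hballE := hballER W_M (by
    filter_upwards [hregae] with g hreg hell'
    exact (hell g hreg ((K2E3TruncatedCharTransport.isCompact_centralizer_iff_of_continuousMulEquiv e g).1 hell'.2)).2)
  have hball := hballR W_M (by
    filter_upwards [hregae] with g hreg hng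
    by_cases hZ : IsCompact ((Subgroup.centralizer ({g} : Set ((UnitaryGroup.cmDatum L 2 (Matrix.of fun i j : Fin 2 => if i.val + j.val + 1 = 2 then (1 : L) else 0)).Local v))) : Set ((UnitaryGroup.cmDatum L 2 (Matrix.of fun i j : Fin 2 => if i.val + j.val + 1 = 2 then (1 : L) else 0)).Local v))
    · obtain ⟨hint, hle⟩ := hell g hreg ((K2E3TruncatedCharTransport.isCompact_centralizer_iff_of_continuousMulEquiv e g).1 hZ)
      exact (setIntegral_le_integral hint.norm (Eventually.of_forall fun x => norm_nonneg _)).trans hle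
    · exact hsplit g hreg hZ)
  exact K2E3SupercuspidalTruncatedCharDominationOfBricks.sigSCan_datum_of_bricks L 2 (Matrix.of fun i j : Fin 2 => if i.val + j.val + 1 = 2 then (1 : L) else 0)
    (UnitaryGroup.antidiagOne_isHermitian L 2) (UnitaryGroup.isUnit_antidiagOne_det L 2).ne_zero v hns μ r hsc B hBinv v₁ Ω F hlim Bset hBsetc hcanc
    (fun g => W_M (e g)) hballE hball hW

end Summit.HodgeConjecture.HodgeConjecture.Cruxes.H413.K2E3SupercuspidalTruncatedCharAnalyticOfEllWeightPlaceTwo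

end
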